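import Mathlib
import HarnessLib
import Summits.HubbardSuperconductivity.HubbardSuperconductivity.Theorems.KLProgrammeKLRegimeTwoVolumeGridReadout

/-!
# Route `KLProgramme` — ENGINE child `KLRegimeEngineV16` (stmt-HubbardSuperconductivity-20236), `stub_twoLeg_scale0`, conjunct
# (E3f-AT)₀, spatial nested leg `hsp`: the GRID READ-OUT at the level of the interpolant's VALUE (cell gate-hubbard-kl, seat
# hubbard-kl-k3c5-p2 g6, β′ lane, step (m5)-b, part 2)

Sequel of `…TwoVolumeGridReadout` (§3 there: pinned coefficient difference + far tail `≤ (2N/|β|)·[pinned two-leg grid defect at the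
block-centre pin]`) composed with `…TwoVolumeSymInterp` ((m5)-a):

* **`abs_eval_symInterp_re_selfEnergy_sub_le_gridDefect`**: for two nested volumes `Lf = b·Lc` on the common `N`-point time grid, grid
  representations `G = map S W`, `G' = map S' W'` with `k⃗`-even self-energy data and base-point–independent phase-weighted rows, the block
  embedding `ι` onto the centred block and a base point at the origin, for EVERY continuum momentum `q`:
  `|(symInterp Lc (Re Σ_G((ω,·),σ))).eval q − (symInterp Lf (Re Σ_{G'}((ω,·),σ))).eval q|`
  `≤ (2N/|β|)·[Σ_{p₁} ‖W(o,p₁) − W'(ι o, ι p₁)‖ + Σ_{p₁' ∉ range ι} ‖W'(ι o, p₁')‖]`;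
* `eval_symInterp_locRe_eq` (linearity bookkeeping) and **`abs_eval_symInterp_locRe_sub_le_gridDefect`**: the same for the localised data
  `¼Σ_σ[Re Σ((ω₀,·),σ) + Re Σ((−ω₀,·),σ)]` — the shape `klLocSelfEnergyRe`/`klLocalPart` read — with majorant `(N/|β|)·Σ_σ defect_σ`
  (the defect carries no phase, so both frequencies give the same bound).

Proofs only; no definitions; nothing is asserted about the model.
-/

noncomputable section

namespace Summit.HubbardSuperconductivity.HubbardSuperconductivity.Theorems.TwoVolumeDefect

set_option linter.dupNamespace false -- summit = problem name (single-conjunct summit), D-0017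

open Finset Complex Literature.MathematicalPhysics.QuantumLattice Literature.Probability.LatticeModels GrassmannAlgebra
open Summit.HubbardSuperconductivity.HubbardSuperconductivity.Theorems.KLRegimeSplit
open Summit.HubbardSuperconductivity.HubbardSuperconductivity.Theorems.TwoPointAssembly
open Summit.HubbardSuperconductivity.HubbardSuperconductivity.Theorems.TwoLegFourier
open scoped ComplexConjugate

/-! ## §4 The interpolant's two-volume difference ≤ the pinned grid defect (plain and localised data) -/

section Readout

variable {b Lc Lf M : ℕ} [NeZero Lc] [NeZero Lf]
variable {P P' : Type*} [Fintype P] [DecidableEq P] [Fintype P'] [DecidableEq P']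

/-- **THE GRID READ-OUT (one frequency, one spin).**  Under the hypotheses of `pinned_add_far_le_gridDefect`, for every continuum momentum `q`:
`|(symInterp Lc (Re Σ_G((ω,·),σ))).eval q − (symInterp Lf (Re Σ_{G'}((ω,·),σ))).eval q| ≤ (2N/|β|)·[pinned two-leg grid defect at ι o]`. -/
theorem abs_eval_symInterp_re_selfEnergy_sub_le_gridDefect [NeZero M] (hL : Lf = b * Lc) {β : ℝ} (hβ : β ≠ 0) {N : ℕ}
    (x : P → TorusSite 2 Lc) (τ : P → ℝ) (x' : P' → TorusSite 2 Lf) (τ' : P' → ℝ)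
    (hP : Fintype.card P = N * Lc ^ 2) (hP' : Fintype.card P' = N * Lf ^ 2)
    (ι : P → P') (hι : Function.Injective ι) (hιx : ∀ p, x' (ι p) = Torus.proj Lf (Torus.cRep (x p))) (hιτ : ∀ p, τ' (ι p) = τ p)
    (hblock : ∀ p' : P', Torus.proj Lf (Torus.cRep (fun i => (((x' p' i).val : ℕ) : ZMod Lc))) = x' p' → p' ∈ Set.range ι)
    {o : P} (hxo : x o = 0) (W : GrassmannAlgebra ℂ (GridLeg P)) (W' : GrassmannAlgebra ℂ (GridLeg P')) (n : MatsubaraIdx M) (σ : Fin 2)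
    (heven : ∀ k : TorusSite 2 Lc,
      selfEnergy Lc M β (ExteriorAlgebra.map (Matrix.toLin' (gridSubMatrix Lc M β x τ)) W) (n, -k) σ =
        selfEnergy Lc M β (ExteriorAlgebra.map (Matrix.toLin' (gridSubMatrix Lc M β x τ)) W) (n, k) σ)
    (heven' : ∀ k : TorusSite 2 Lf,
      selfEnergy Lf M β (ExteriorAlgebra.map (Matrix.toLin' (gridSubMatrix Lf M β x' τ')) W') (n, -k) σ =
        selfEnergy Lf M β (ExteriorAlgebra.map (Matrix.toLin' (gridSubMatrix Lf M β x' τ')) W') (n, k) σ)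
    (hrow : ∀ (p₀ : P) (y : TorusSite 2 Lc),
      (∑ p₁ : P, if x p₁ = x p₀ + y then
        Complex.exp (((matsubaraFreq β M n * (τ p₀ - τ p₁) : ℝ) : ℂ) * Complex.I) * kernel ℂ W 2 (fun i => ((![p₀, p₁] i, σ), i))
        else 0) =
      ∑ p₁ : P, if x p₁ = x o + y then
        Complex.exp (((matsubaraFreq β M n * (τ o - τ p₁) : ℝ) : ℂ) * Complex.I) * kernel ℂ W 2 (fun i => ((![o, p₁] i, σ), i))
        else 0)
    (hrow' : ∀ (p₀' : P') (y : TorusSite 2 Lf),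
      (∑ p₁' : P', if x' p₁' = x' p₀' + y then
        Complex.exp (((matsubaraFreq β M n * (τ' p₀' - τ' p₁') : ℝ) : ℂ) * Complex.I) * kernel ℂ W' 2 (fun i => ((![p₀', p₁'] i, σ), i))
        else 0) =
      ∑ p₁' : P', if x' p₁' = x' (ι o) + y then
        Complex.exp (((matsubaraFreq β M n * (τ' (ι o) - τ' p₁') : ℝ) : ℂ) * Complex.I) * kernel ℂ W' 2 (fun i => ((![ι o, p₁'] i, σ), i))
        else 0)
    (q : Fin 2 → ℝ) :
    |(symInterp Lc (fun k => (selfEnergy Lc M β (ExteriorAlgebra.map (Matrix.toLin' (gridSubMatrix Lc M β x τ)) W) (n, k) σ).re)).eval q -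
      (symInterp Lf (fun k => (selfEnergy Lf M β (ExteriorAlgebra.map (Matrix.toLin' (gridSubMatrix Lf M β x' τ')) W') (n, k) σ).re)).eval q| ≤
      2 * N / |β| *
        ((∑ p₁ : P, ‖kernel ℂ W 2 (fun i => ((![o, p₁] i, σ), i)) - kernel ℂ W' 2 (fun i => ((![ι o, ι p₁] i, σ), i))‖) +
          ∑ p₁' ∈ univ.filter (fun p₁' : P' => p₁' ∉ Set.range ι), ‖kernel ℂ W' 2 (fun i => ((![ι o, p₁'] i, σ), i))‖) :=
  (abs_eval_symInterp_sub_le_pinned_add_far hL _ _ q).trans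
    (pinned_add_far_le_gridDefect hL hβ x τ x' τ' hP hP' ι hι hιx hιτ hblock hxo W W' n σ heven heven' hrow hrow')

/-- Cosine coefficients of localised data: `c_{¼Σ_σ(f_{ω₀,σ} + f_{−ω₀,σ})} = ¼Σ_σ (c_{f_{ω₀,σ}} + c_{f_{−ω₀,σ}})` at the level of the interpolant's value. -/
theorem eval_symInterp_locRe_eq {L : ℕ} [NeZero L] [NeZero M] (Sg : FreqMomentum L M → Fin 2 → ℂ) (q : Fin 2 → ℝ) :
    (symInterp L (fun k => (∑ σ : Fin 2, ((Sg (omega0 M, k) σ).re + (Sg ((omega0 M).rev, k) σ).re)) / 4)).eval q =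
      (∑ σ : Fin 2, ((symInterp L (fun k => (Sg (omega0 M, k) σ).re)).eval q +
        (symInterp L (fun k => (Sg ((omega0 M).rev, k) σ).re)).eval q)) / 4 := by
  simp only [eval_symInterp, torusCosCoeff, Fin.sum_univ_two, Finset.mul_sum, Finset.sum_mul, Finset.sum_div, add_div,
    ← Finset.sum_add_distrib]
  refine Finset.sum_congr rfl fun x _ => Finset.sum_congr rfl fun k _ => ?_
  ring

/-- **THE GRID READ-OUT FOR THE LOCALISED DATA** `¼Σ_σ[Re Σ((ω₀,·),σ) + Re Σ((−ω₀,·),σ)]` (the shape of `klLocSelfEnergyRe`): if the four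
strings `(±ω₀, σ)` satisfy the hypotheses of `abs_eval_symInterp_re_selfEnergy_sub_le_gridDefect`, the interpolants at two nested volumes differ
at every continuum momentum by at most `(N/|β|)·Σ_σ [pinned two-leg grid defect of the σ-string at ι o]` (the defect carries no phase, so
the two frequencies give the same majorant). -/
theorem abs_eval_symInterp_locRe_sub_le_gridDefect [NeZero M] (hL : Lf = b * Lc) {β : ℝ} (hβ : β ≠ 0) {N : ℕ}
    (x : P → TorusSite 2 Lc) (τ : P → ℝ) (x' : P' → TorusSite 2 Lf) (τ' : P' → ℝ)
    (hP : Fintype.card P = N * Lc ^ 2) (hP' : Fintype.card P' = N * Lf ^ 2)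
    (ι : P → P') (hι : Function.Injective ι) (hιx : ∀ p, x' (ι p) = Torus.proj Lf (Torus.cRep (x p))) (hιτ : ∀ p, τ' (ι p) = τ p)
    (hblock : ∀ p' : P', Torus.proj Lf (Torus.cRep (fun i => (((x' p' i).val : ℕ) : ZMod Lc))) = x' p' → p' ∈ Set.range ι)
    {o : P} (hxo : x o = 0) (W : GrassmannAlgebra ℂ (GridLeg P)) (W' : GrassmannAlgebra ℂ (GridLeg P'))
    (heven : ∀ (n : MatsubaraIdx M) (σ : Fin 2) (k : TorusSite 2 Lc), (n = omega0 M ∨ n = (omega0 M).rev) →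
      selfEnergy Lc M β (ExteriorAlgebra.map (Matrix.toLin' (gridSubMatrix Lc M β x τ)) W) (n, -k) σ =
        selfEnergy Lc M β (ExteriorAlgebra.map (Matrix.toLin' (gridSubMatrix Lc M β x τ)) W) (n, k) σ)
    (heven' : ∀ (n : MatsubaraIdx M) (σ : Fin 2) (k : TorusSite 2 Lf), (n = omega0 M ∨ n = (omega0 M).rev) →
      selfEnergy Lf M β (ExteriorAlgebra.map (Matrix.toLin' (gridSubMatrix Lf M β x' τ')) W') (n, -k) σ =
        selfEnergy Lf M β (ExteriorAlgebra.map (Matrix.toLin' (gridSubMatrix Lf M β x' τ')) W') (n, k) σ)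
    (hrow : ∀ (n : MatsubaraIdx M) (σ : Fin 2) (p₀ : P) (y : TorusSite 2 Lc), (n = omega0 M ∨ n = (omega0 M).rev) →
      (∑ p₁ : P, if x p₁ = x p₀ + y then
        Complex.exp (((matsubaraFreq β M n * (τ p₀ - τ p₁) : ℝ) : ℂ) * Complex.I) * kernel ℂ W 2 (fun i => ((![p₀, p₁] i, σ), i))
        else 0) =
      ∑ p₁ : P, if x p₁ = x o + y then
        Complex.exp (((matsubaraFreq β M n * (τ o - τ p₁) : ℝ) : ℂ) * Complex.I) * kernel ℂ W 2 (fun i => ((![o, p₁] i, σ), i))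
        else 0)
    (hrow' : ∀ (n : MatsubaraIdx M) (σ : Fin 2) (p₀' : P') (y : TorusSite 2 Lf), (n = omega0 M ∨ n = (omega0 M).rev) →
      (∑ p₁' : P', if x' p₁' = x' p₀' + y then
        Complex.exp (((matsubaraFreq β M n * (τ' p₀' - τ' p₁') : ℝ) : ℂ) * Complex.I) * kernel ℂ W' 2 (fun i => ((![p₀', p₁'] i, σ), i))
        else 0) =
      ∑ p₁' : P', if x' p₁' = x' (ι o) + y then
        Complex.exp (((matsubaraFreq β M n * (τ' (ι o) - τ' p₁') : ℝ) : ℂ) * Complex.I) * kernel ℂ W' 2 (fun i => ((![ι o, p₁'] i, σ), i))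
        else 0)
    (q : Fin 2 → ℝ) :
    |(symInterp Lc (fun k => (∑ σ : Fin 2,
        ((selfEnergy Lc M β (ExteriorAlgebra.map (Matrix.toLin' (gridSubMatrix Lc M β x τ)) W) (omega0 M, k) σ).re +
         (selfEnergy Lc M β (ExteriorAlgebra.map (Matrix.toLin' (gridSubMatrix Lc M β x τ)) W) ((omega0 M).rev, k) σ).re)) / 4)).eval q -
      (symInterp Lf (fun k => (∑ σ : Fin 2,
        ((selfEnergy Lf M β (ExteriorAlgebra.map (Matrix.toLin' (gridSubMatrix Lf M β x' τ')) W') (omega0 M, k) σ).re +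
         (selfEnergy Lf M β (ExteriorAlgebra.map (Matrix.toLin' (gridSubMatrix Lf M β x' τ')) W') ((omega0 M).rev, k) σ).re)) / 4)).eval q| ≤
      N / |β| * ∑ σ : Fin 2,
        ((∑ p₁ : P, ‖kernel ℂ W 2 (fun i => ((![o, p₁] i, σ), i)) - kernel ℂ W' 2 (fun i => ((![ι o, ι p₁] i, σ), i))‖) +
          ∑ p₁' ∈ univ.filter (fun p₁' : P' => p₁' ∉ Set.range ι), ‖kernel ℂ W' 2 (fun i => ((![ι o, p₁'] i, σ), i))‖) := by
  rw [eval_symInterp_locRe_eq (fun K σ => selfEnergy Lc M β (ExteriorAlgebra.map (Matrix.toLin' (gridSubMatrix Lc M β x τ)) W) K σ) q,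
    eval_symInterp_locRe_eq (fun K σ => selfEnergy Lf M β (ExteriorAlgebra.map (Matrix.toLin' (gridSubMatrix Lf M β x' τ')) W') K σ) q]
  set D : Fin 2 → ℝ := fun σ =>
    (∑ p₁ : P, ‖kernel ℂ W 2 (fun i => ((![o, p₁] i, σ), i)) - kernel ℂ W' 2 (fun i => ((![ι o, ι p₁] i, σ), i))‖) +
      ∑ p₁' ∈ univ.filter (fun p₁' : P' => p₁' ∉ Set.range ι), ‖kernel ℂ W' 2 (fun i => ((![ι o, p₁'] i, σ), i))‖ with hD
  have hstring : ∀ (n : MatsubaraIdx M) (σ : Fin 2), (n = omega0 M ∨ n = (omega0 M).rev) →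
      |(symInterp Lc (fun k => (selfEnergy Lc M β (ExteriorAlgebra.map (Matrix.toLin' (gridSubMatrix Lc M β x τ)) W) (n, k) σ).re)).eval q -
        (symInterp Lf (fun k => (selfEnergy Lf M β (ExteriorAlgebra.map (Matrix.toLin' (gridSubMatrix Lf M β x' τ')) W') (n, k) σ).re)).eval q| ≤
      2 * N / |β| * D σ :=
    fun n σ hn => abs_eval_symInterp_re_selfEnergy_sub_le_gridDefect hL hβ x τ x' τ' hP hP' ι hι hιx hιτ hblock hxo W W' n σ
      (fun k => heven n σ k hn) (fun k => heven' n σ k hn) (fun p₀ y => hrow n σ p₀ y hn) (fun p₀' y => hrow' n σ p₀' y hn) q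
  have h00 := hstring (omega0 M) 0 (Or.inl rfl)
  have h01 := hstring (omega0 M).rev 0 (Or.inr rfl)
  have h10 := hstring (omega0 M) 1 (Or.inl rfl)
  have h11 := hstring (omega0 M).rev 1 (Or.inr rfl)
  simp only [Fin.sum_univ_two]
  set A00 := (symInterp Lc (fun k => (selfEnergy Lc M β (ExteriorAlgebra.map (Matrix.toLin' (gridSubMatrix Lc M β x τ)) W) (omega0 M, k) 0).re)).eval q
  set A01 := (symInterp Lc (fun k => (selfEnergy Lc M β (ExteriorAlgebra.map (Matrix.toLin' (gridSubMatrix Lc M β x τ)) W) ((omega0 M).rev, k) 0).re)).eval q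
  set A10 := (symInterp Lc (fun k => (selfEnergy Lc M β (ExteriorAlgebra.map (Matrix.toLin' (gridSubMatrix Lc M β x τ)) W) (omega0 M, k) 1).re)).eval q
  set A11 := (symInterp Lc (fun k => (selfEnergy Lc M β (ExteriorAlgebra.map (Matrix.toLin' (gridSubMatrix Lc M β x τ)) W) ((omega0 M).rev, k) 1).re)).eval q
  set B00 := (symInterp Lf (fun k => (selfEnergy Lf M β (ExteriorAlgebra.map (Matrix.toLin' (gridSubMatrix Lf M β x' τ')) W') (omega0 M, k) 0).re)).eval q
  set B01 := (symInterp Lf (fun k => (selfEnergy Lf M β (ExteriorAlgebra.map (Matrix.toLin' (gridSubMatrix Lf M β x' τ')) W') ((omega0 M).rev, k) 0).re)).eval q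
  set B10 := (symInterp Lf (fun k => (selfEnergy Lf M β (ExteriorAlgebra.map (Matrix.toLin' (gridSubMatrix Lf M β x' τ')) W') (omega0 M, k) 1).re)).eval q
  set B11 := (symInterp Lf (fun k => (selfEnergy Lf M β (ExteriorAlgebra.map (Matrix.toLin' (gridSubMatrix Lf M β x' τ')) W') ((omega0 M).rev, k) 1).re)).eval q
  have e : (A00 + A01 + (A10 + A11)) / 4 - (B00 + B01 + (B10 + B11)) / 4 =
      ((A00 - B00) + (A01 - B01) + ((A10 - B10) + (A11 - B11))) / 4 := by ring
  rw [e, abs_div, abs_of_pos (by norm_num : (0 : ℝ) < 4), div_le_iff₀ (by norm_num : (0 : ℝ) < 4)]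
  have hnum : |(A00 - B00) + (A01 - B01) + ((A10 - B10) + (A11 - B11))| ≤
      2 * N / |β| * D 0 + 2 * N / |β| * D 0 + (2 * N / |β| * D 1 + 2 * N / |β| * D 1) :=
    (abs_add_le _ _).trans (add_le_add ((abs_add_le _ _).trans (add_le_add h00 h01)) ((abs_add_le _ _).trans (add_le_add h10 h11)))
  have hT : 2 * N / |β| * D 0 + 2 * N / |β| * D 0 + (2 * N / |β| * D 1 + 2 * N / |β| * D 1) = N / |β| * (D 0 + D 1) * 4 := by ring
  linarith

end Readout

end Summit.HubbardSuperconductivity.HubbardSuperconductivity.Theorems.TwoVolumeDefect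

end
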